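import Literature.NumberTheory.EllipticCurves.HeegnerPointsKolyvaginPrimaryOrderCTValueProofs
import HarnessLib

/-!
# The value formula `hCTV` of Kolyvagin's order bound, at the descent data, from the local term at `λ`

Topic `NumberTheory/EllipticCurves`; namespace `Literature.NumberTheory.EllipticCurves`. Theorems only:
**no definition and no named fact is introduced** (D-0026). Sequel of
`HeegnerPointsKolyvaginPrimaryOrderCTValueProofs` (McCallum's Prop. 4.7 for the concrete classes of
the descent) addressed to the consumer `HeegnerPointsKolyvaginPrimaryOrderTelescopeProofs`
(`KolyvaginDescent.HypothesesM.sum_expo_le_M₀_of_casselsTate`, hypothesis `hCTV`).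

For descent data `S : KolyvaginDescent.HypothesesM (H¹(K, E[p^{2M₀}])) _` carrying the dictionary of
`HeegnerPointsKolyvaginPrimaryLeavesDictionaryProofs` (`S.Sel = Sel^{(p^{2M₀})}(E/K)`, `S.p = p`,
`S.M₀ = M₀`, `S.M = 2M₀`, `S.τ = c_*`, `S.Kol =` Kolyvagin primes of level `p^{2M₀}`,
`S.A ℓ = {g | g_v = 0, v ∣ ℓ}`, `S.c = c_M`, `S.ε = ε`), and for the pairing
`P(z, t) = B(ι z, ι t)` on `S.Sel` obtained from the level-`p^{M₀}` Cassels–Tate pairing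
`B = ctLevelPairing` (auxiliary level `p^{2M₀}`) and `ι : Sel^{(p^{2M₀})} → Ш[p^{M₀}]`
(`CasselsTateSelmerPullback`), the hypothesis `hCTV` of the telescope — *McCallum's Prop. 4.7 with
Lemma 5.3 and Prop. 4.4 in order language* — FOLLOWS from its purely LOCAL residue at `λ`:

* `KolyvaginDescent.HypothesesM.hCTV_of_localTerm` — if for all the data of `hCTV` (Kolyvagin prime
  `ℓ`, `n = ℓ m`, `j, N, a, b`, `t`, with the order conditions *"`p^{a+(j-N)} c(m)_λ ≠ 0`"*,
  *"`p^b t_λ ≠ 0`"*) every first-case datum `D` with `D.b₁ = p^{j-M₀} c(n)`, `ι_* D.b' = t` has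
  `inv_λ((loc_λ D.b₁ - β_λ) ∪ β'_λ) ≠ 0` (hypothesis `hloc`; McCallum's Lemma 5.3), then `hCTV` holds
  for `P`.

So after this file the Cassels–Tate input of Kolyvagin's ORDER bound (`card_quotient_le_of_casselsTate`)
consists of: `hloc` (local, at `λ`), the inputs `halt`, `hPT'`, `hH3`, `hfin` of the tree's
`ctLevelPairing`, and `Ш[p^{2M₀}] ⊆ Ш[p^{M₀}]` (for `ι`). Nothing on the BSD side is asserted.

## References

* [McCallumLMS1991] W. G. McCallum, *Kolyvagin's work on Shafarevich–Tate groups* (1991), §4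
  Prop. 4.4, Prop. 4.7; §5 Lemma 5.3, Thm. 5.4 (proof), Cor. 5.6.
* [MilneADT2006] J. S. Milne, *Arithmetic Duality Theorems*, 2nd ed. (2006), Ch. I §6, Prop. 6.9.
-/

noncomputable section

open scoped Classical
open scoped AddSubgroup

universe u

namespace Literature.NumberTheory.EllipticCurves

namespace KolyvaginDescent

namespace HypothesesM

open CategoryTheory _root_.WeierstrassCurve Field Function NumberField IsDedekindDomain
open Literature.NumberTheory.GaloisRepresentations Literature.NumberTheory.GaloisCohomology
open Literature.NumberTheory.GaloisRepresentations.DiscreteGaloisModule (mu MuCarrier pairing)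
open Literature.GroupTheory.FiniteAbelian
open scoped ContRepresentation

-- Cup products need `LocallyCompactSpace Γ`; as in the tree's cup-product files, the compactness of
-- absolute Galois groups is a local instance only.
attribute [local instance] absoluteGaloisGroup_compactSpace

-- `char K_v = 0` for the completions of a number field (local instance, no override).
attribute [local instance] charZero_placeCompletion

variable (W : WeierstrassCurve ℚ) {K : Type u} [Field K] [NumberField K]
variable [W.IsElliptic] {p M₀ : ℕ} [NeZero (p ^ M₀)]
variable (e : geomTorsion (W.baseChange K) ((p ^ M₀ * p ^ M₀ : ℕ) : ℤ) →
    geomTorsion (W.baseChange K) ((p ^ M₀ * p ^ M₀ : ℕ) : ℤ) → AlgebraicClosure K)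
  (hμ : ∀ S T, e S T ^ (p ^ M₀ * p ^ M₀) = 1)
  (hadd₁ : ∀ S₁ S₂ T, e (S₁ + S₂) T = e S₁ T * e S₂ T)
  (hadd₂ : ∀ S T₁ T₂, e S (T₁ + T₂) = e S T₁ * e S T₂)
  (hgal : ∀ (σ : absoluteGaloisGroup K) (S T : geomTorsion (W.baseChange K) ((p ^ M₀ * p ^ M₀ : ℕ) : ℤ)),
    σ • e S T = e (σ • S) (σ • T))
variable (inv : LocalInvariants K (p ^ M₀ * p ^ M₀))
-- `hPT'` is the reciprocity predicate `LocalInvariants.SumInvLocalizationEqZero` on `inv`, not a named fact.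
variable (halt : ∀ T, e T T = 1) (hPT' : inv.SumInvLocalizationEqZero)
  (hH3 : ∀ c : galoisCohomology (mu K (p ^ M₀ * p ^ M₀)) 3,
    (∀ v : Place K, galoisCohomology.localization (mu K (p ^ M₀ * p ^ M₀)) v 3 c = 0) → c = 0)
  (hfin : ∀ D : GeneralCaseData (W.baseChange K) (p ^ M₀) e hμ hadd₁ hadd₂ hgal,
    ∃ S : Finset (Place K), ∀ v ∉ S, D.localTerm inv v = 0)
variable (ι : selmerGroup (W.baseChange K) ((p ^ M₀ * p ^ M₀ : ℕ) : ℤ) →+ ((W.baseChange K).sha)[p ^ M₀])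
  (hι : ∀ z, shaTorsionVal (W.baseChange K) (p ^ M₀) (ι z) =
    torsionH1ToH1 (W.baseChange K) ((p ^ M₀ * p ^ M₀ : ℕ) : ℤ) z)

include halt hPT' hι in
/-- **`hCTV` from the local term at `λ`.** Let `S` be descent data on `H¹(K, E[p^{2M₀}])` with the
dictionary of `exists_hypothesesM_of_leavesM_dictionary_level` (at `n = p^{M₀} · p^{M₀}`, `M = 2M₀`),
the classes `c(·)` satisfying McCallum's Lemma 4.3 (Selmer off `n`, leaf (A)), and let
`P = B(ι ·, ι ·)` on `S.Sel` be the pulled-back level-`p^{M₀}` Cassels–Tate pairing (through the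
identification `S.Sel = Sel^{(p^{2M₀})}(E/K)`). If McCallum's Lemma 5.3 holds at `λ` for the
first-case data of every Kolyvagin pair of the telescope (`hloc`: the local term
`inv_λ((loc_λ D.b₁ - β_λ) ∪ β'_λ)` is non-zero under the order conditions
*"`ord c(m)_λ`, `ord t_λ` multiply to more than `p^N`"* of the proof of Thm. 5.4), then the value
formula `hCTV` of `sum_expo_le_M₀_of_casselsTate` / `card_quotient_le_of_casselsTate` holds for `P`
(all other local terms vanish: `ctLevelPairing_pullback_ne_zero_iff_localTerm_kolyvaginClass`).
[cite: McCallumLMS1991, §4 Prop. 4.7, §5 Lemma 5.3, Thm. 5.4 (proof)] [cite: MilneADT2006, Ch. I §6, Prop. 6.9] -/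
theorem hCTV_of_localTerm
    (hK : IsImaginaryQuadratic K) {N₀ : ℕ} [NeZero N₀] {Pt : (W.baseChange K).toAffine.Point}
    (hP : IsHeegnerPoint N₀ W K Pt) (hp : p.Prime) (hp2 : p ≠ 2) (hρ : W.HasSurjectiveModNGaloisRep p)
    (c : K ≃ₐ[ℚ] K) (ε : ℤ) (cl : ℕ → galH1Torsion (W.baseChange K) ((p ^ M₀ * p ^ M₀ : ℕ) : ℤ))
    (hcl : ∀ n : ℕ, Squarefree n →
      (∀ q ∈ n.primeFactors, IsKolyvaginPrime N₀ W K p q ∧ FrobEqFrobInfty W K (p ^ M₀ * p ^ M₀) q) →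
      ∀ v : HeightOneSpectrum (𝓞 K), (n : 𝓞 K) ∉ v.asIdeal →
        cl n ∈ selmerLocalKer (W.baseChange K) (v.adicCompletion K) ((p ^ M₀ * p ^ M₀ : ℕ) : ℤ))
    (S : HypothesesM (galH1Torsion (W.baseChange K) ((p ^ M₀ * p ^ M₀ : ℕ) : ℤ))
      (HeightOneSpectrum (𝓞 K) ⊕ InfinitePlace K))
    (hSel : S.Sel = selmerGroup (W.baseChange K) ((p ^ M₀ * p ^ M₀ : ℕ) : ℤ)) (hSp : S.p = p)
    (hSM₀ : S.M₀ = M₀) (hSM : S.M = 2 * M₀)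
    (hSτ : ∀ g, S.τ g = conjAct W c ((p ^ M₀ * p ^ M₀ : ℕ) : ℤ) g)
    (hSKol : ∀ ℓ, S.Kol ℓ ↔ IsKolyvaginPrime N₀ W K p ℓ ∧ FrobEqFrobInfty W K (p ^ M₀ * p ^ M₀) ℓ)
    (hSA : ∀ ℓ g, g ∈ S.A ℓ ↔ ∀ v : HeightOneSpectrum (𝓞 K), (ℓ : 𝓞 K) ∈ v.asIdeal →
      g ∈ (W.baseChange K).torsionLocalKer (v.adicCompletion K) ((p ^ M₀ * p ^ M₀ : ℕ) : ℤ))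
    (hSc : ∀ n, S.c n = cl n) (hSε : S.ε = ε)
    (hloc : ∀ ℓ m : ℕ,
      (hℓ : IsKolyvaginPrime N₀ W K p ℓ ∧ FrobEqFrobInfty W K (p ^ M₀ * p ^ M₀) ℓ) →
      KolSupp (fun q => IsKolyvaginPrime N₀ W K p q ∧ FrobEqFrobInfty W K (p ^ M₀ * p ^ M₀) q) (ℓ * m) →
      ¬ ℓ ∣ m →
      ∀ (j N a b : ℕ) (t : galH1Torsion (W.baseChange K) ((p ^ M₀ * p ^ M₀ : ℕ) : ℤ)),
      t ∈ selmerGroup (W.baseChange K) ((p ^ M₀ * p ^ M₀ : ℕ) : ℤ) →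
      ((p : ℤ) ^ j) • cl (ℓ * m) ∈ selmerGroup (W.baseChange K) ((p ^ M₀ * p ^ M₀ : ℕ) : ℤ) →
      ((p : ℤ) ^ N) • t = 0 →
      conjAct W c ((p ^ M₀ * p ^ M₀ : ℕ) : ℤ) t = (ε * (-1) ^ (ℓ * m).primeFactors.card) • t →
      (∀ q ∈ m.primeFactors, ∀ v : HeightOneSpectrum (𝓞 K), (q : 𝓞 K) ∈ v.asIdeal →
        t ∈ (W.baseChange K).torsionLocalKer (v.adicCompletion K) ((p ^ M₀ * p ^ M₀ : ℕ) : ℤ)) →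
      M₀ ≤ j → N ≤ M₀ → N ≤ j → a + b + 1 = N →
      (¬ ∀ v : HeightOneSpectrum (𝓞 K), (ℓ : 𝓞 K) ∈ v.asIdeal →
        ((p : ℤ) ^ (a + (j - N))) • cl m ∈
          (W.baseChange K).torsionLocalKer (v.adicCompletion K) ((p ^ M₀ * p ^ M₀ : ℕ) : ℤ)) →
      (¬ ∀ v : HeightOneSpectrum (𝓞 K), (ℓ : 𝓞 K) ∈ v.asIdeal →
        ((p : ℤ) ^ b) • t ∈ (W.baseChange K).torsionLocalKer (v.adicCompletion K) ((p ^ M₀ * p ^ M₀ : ℕ) : ℤ)) →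
      ∀ D : FirstCaseData (W.baseChange K) (p ^ M₀), D.b₁ = ((p : ℤ) ^ (j - M₀)) • cl (ℓ * m) →
        galoisCohomology.map (inclKD (W.baseChange K) (p ^ M₀) (p ^ M₀)) 1 D.b' = t →
        D.localTerm e hμ hadd₁ hadd₂ hgal inv (Sum.inr hℓ.1.place) ≠ 0) :
    ∀ ℓ m : ℕ, S.Kol ℓ → KolSupp S.Kol (ℓ * m) → ¬ ℓ ∣ m →
      ∀ (j N a b : ℕ) (t : galH1Torsion (W.baseChange K) ((p ^ M₀ * p ^ M₀ : ℕ) : ℤ))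
        (ht : t ∈ S.Sel) (hz : ((S.p : ℤ) ^ j) • S.c (ℓ * m) ∈ S.Sel),
      ((S.p : ℤ) ^ N) • t = 0 → S.τ t = (S.ε * (-1) ^ (ℓ * m).primeFactors.card) • t →
      (∀ q ∈ m.primeFactors, t ∈ S.A q) → S.M - S.M₀ ≤ j → N + S.M₀ ≤ S.M → N ≤ j → a + b + 1 = N →
      ((S.p : ℤ) ^ (a + (j - N))) • S.c m ∉ S.A ℓ → ((S.p : ℤ) ^ b) • t ∉ S.A ℓ →
      (((ctLevelPairing (W.baseChange K) (p ^ M₀) e hμ hadd₁ hadd₂ hgal inv halt hPT' hH3 hfin).comp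
          (ι.comp (AddSubgroup.inclusion hSel.le))).compl₂ (ι.comp (AddSubgroup.inclusion hSel.le)))
        ⟨_, hz⟩ ⟨t, ht⟩ ≠ 0 := by
  intro ℓ m hKolℓ hsupp hℓm j N a b t ht hz hpt hτt hAq hMj hNM hNj hab hordc hordt
  -- translate through the dictionary
  have hℓ : IsKolyvaginPrime N₀ W K p ℓ ∧ FrobEqFrobInfty W K (p ^ M₀ * p ^ M₀) ℓ := (hSKol ℓ).mp hKolℓ
  have hsupp' : KolSupp (fun q => IsKolyvaginPrime N₀ W K p q ∧ FrobEqFrobInfty W K (p ^ M₀ * p ^ M₀) q)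
      (ℓ * m) := ⟨hsupp.1, fun q hq => (hSKol q).mp (hsupp.2 q hq)⟩
  have ht' : t ∈ selmerGroup (W.baseChange K) ((p ^ M₀ * p ^ M₀ : ℕ) : ℤ) := hSel ▸ ht
  have hz' : ((p : ℤ) ^ j) • cl (ℓ * m) ∈ selmerGroup (W.baseChange K) ((p ^ M₀ * p ^ M₀ : ℕ) : ℤ) := by
    have h := hz
    rw [hSp, hSc, hSel] at h
    exact h
  have hpt' : ((p : ℤ) ^ N) • t = 0 := by
    have h := hpt
    rw [hSp] at h
    exact h
  have hτt' : conjAct W c ((p ^ M₀ * p ^ M₀ : ℕ) : ℤ) t = (ε * (-1) ^ (ℓ * m).primeFactors.card) • t := by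
    rw [← hSτ, ← hSε]; exact hτt
  have hAq' : ∀ q ∈ m.primeFactors, ∀ v : HeightOneSpectrum (𝓞 K), (q : 𝓞 K) ∈ v.asIdeal →
      t ∈ (W.baseChange K).torsionLocalKer (v.adicCompletion K) ((p ^ M₀ * p ^ M₀ : ℕ) : ℤ) :=
    fun q hq => (hSA q t).mp (hAq q hq)
  have hMj' : M₀ ≤ j := by rw [hSM, hSM₀] at hMj; omega
  have hNM' : N ≤ M₀ := by rw [hSM, hSM₀] at hNM; omega
  have hordc' : ¬ ∀ v : HeightOneSpectrum (𝓞 K), (ℓ : 𝓞 K) ∈ v.asIdeal →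
      ((p : ℤ) ^ (a + (j - N))) • cl m ∈
        (W.baseChange K).torsionLocalKer (v.adicCompletion K) ((p ^ M₀ * p ^ M₀ : ℕ) : ℤ) := by
    intro h
    apply hordc
    rw [hSp, hSc]
    exact (hSA ℓ _).mpr h
  have hordt' : ¬ ∀ v : HeightOneSpectrum (𝓞 K), (ℓ : 𝓞 K) ∈ v.asIdeal →
      ((p : ℤ) ^ b) • t ∈ (W.baseChange K).torsionLocalKer (v.adicCompletion K) ((p ^ M₀ * p ^ M₀ : ℕ) : ℤ) := by
    intro h
    apply hordt
    rw [hSp]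
    exact (hSA ℓ _).mpr h
  -- McCallum Prop. 4.7: the value is the local term at `λ`
  obtain ⟨⟨D, hD₁, hDt⟩, hiff⟩ :=
    ctLevelPairing_pullback_ne_zero_iff_localTerm_kolyvaginClass W e hμ hadd₁ hadd₂ hgal inv halt hPT'
      hH3 hfin ι hι hK hP hp hp2 hρ cl hcl hℓ hsupp' hMj' hNM' ht' hz' hpt' hAq'
  have hne := (hiff D hD₁ hDt).mpr (hloc ℓ m hℓ hsupp' hℓm j N a b t ht' hz' hpt' hτt' hAq' hMj'
    hNM' hNj hab hordc' hordt' D hD₁ hDt)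
  -- unfold `P = B(ι ∘ incl ·, ι ∘ incl ·)`
  have e1 : AddSubgroup.inclusion hSel.le ⟨_, hz⟩ = ⟨_, hz'⟩ :=
    Subtype.ext (show ((S.p : ℤ) ^ j) • S.c (ℓ * m) = ((p : ℤ) ^ j) • cl (ℓ * m) by rw [hSp, hSc])
  have e2 : AddSubgroup.inclusion hSel.le ⟨t, ht⟩ = ⟨t, ht'⟩ := Subtype.ext rfl
  change ctLevelPairing (W.baseChange K) (p ^ M₀) e hμ hadd₁ hadd₂ hgal inv halt hPT' hH3 hfin
      (ι (AddSubgroup.inclusion hSel.le ⟨_, hz⟩)) (ι (AddSubgroup.inclusion hSel.le ⟨t, ht⟩)) ≠ 0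
  rw [e1, e2]
  exact hne

end HypothesesM

end KolyvaginDescent

end Literature.NumberTheory.EllipticCurves

end
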